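import Summits.QuantumFields.YangMills.Theorems.UnitScaleTiltProp7SymFrameCovDefs
import Summits.QuantumFields.YangMills.Theorems.UnitScaleTiltProp8ChartDoubleBarDeriv
import Summits.QuantumFields.YangMills.Theorems.UnitScaleTiltProp7SymAvgTwDefs
import Summits.QuantumFields.YangMills.Theorems.UnitScaleTiltProp7SymAvgGLBridge
import HarnessLib

/-!
# Route `UnitScaleTilt`, crux K1 child «MinimiserStabilityRegPr» (stmt-QuantumFields-19200), skeleton v10 stub EX, route (α) — **DEFINITIONS FILE (T³ part): THE RE-BASED
# TWISTED CHART OF RECORD ON THE SYMMETRIC COVARIANT FRAMES, WITH THE TWO SANITY THEOREMS (J1)∕(J2)** (OWNER RULING g26-№12 (T-sym-frames), 2026-08-28 07:35Z): the (T)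
# letters of ✓`Prop7SymAvgTw` — `dbarTw`, `logChartTw`, `QTw`, `CmapTw`, `Chart47T3tw` — BY THE SAME FORMULAS with the accumulated symmetric frame `frameTwS`
# (✓`Prop7SymAvgTwSym.frameAccU` of the sibling generic file, read at a comparison site) in place of the corner-comb frame `frameTw = wrec`; (J1) at `U₀ = 1` the objects ARE
# the H side's ✓`Prop8ChartDoubleBar.dbarIterU`∕`chartLogFlat` (LITERALLY, up to the displayed `η`∕index bookkeeping); (J2) `QTwS 1 = tube^{(k)}` (no leg term).

Cell `ym3-torus` ∕ width seat `ym-ust-20520-w5` (gen 3).  YM₃ on T³ is ladder rung R3, not the Clay problem; nothing here is a claim about the stub, the crux or the gap.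

THE PRINT.  [Balaban1985Averaging] p. 31 (92): «(\overline{R_{0,b₋}U₁^{(k)}})⁻¹Ũ₁^kR̄^k_{0,b}\overline{R_{0,b₊}U₁^{(k)}} = (U̿₁^k)_b»; p. 36 (125)–(127): the linearisation of the double
bar is the straight tube average (the frames' legs cancel the average's legs).  [Balaban1985BackgroundPropagators] p. 392: «the averaging operation used here is the operation U̿ʲ
defined by the formulas (89)–(92) … We replace U₀ by U … (1∕η_j)Q_j(U, ηA) = Q_j(U)A + C_j(U, A) (3.14) where Q_j(U)A is a linear part of the function (3.13)».
[Balaban1985Variational] p. 285: «Q_j(ηA) = LʲηQ_jA + C_j(LʲηA) (44) … C_j(LʲηA′ − LʲηHD(A′)) = D(A′) on Λ_j. (49)», Prop. 3 p. 289.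

WHY THIS FILE (RULING g26-№12, on this seat's (S9)∕(L2) LOCATE).  The (T) chart twists the route's CENTRED symmetric average `descendToGL` with print's CORNER-comb frames
`wrec = vcov`; its linear part at `U₀ = 1` is `tube^{(k)} + δ(S_comb − S_sym)` (a coarse pure-gauge defect: `Prop8ChartDeriv.linAvg_def` has its legs from the CENTRE).  With the
frames re-anchored to the SAME centred `Idx P` staircases the legs cancel as in print's (125): §5 (J2) `QTwS 1 = L^{K−n}·bondAvgIter (K−n)` EXACTLY, and (J1) the chart at
`U₀ = 1` IS `chartLogFlat η D` at the top-level indices — ONE chart functional for the route.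

DECLARED READINGS ∕ HONEST SCOPE.  (i) `QTwS U₀ := fderiv ℂ (logChartTwS U₀) 0` BY DEFINITION; its identification with the covariant symmetric tube at `U₀ ≠ 1`, the frame bounds,
windows and the (44)-twˢ input are NOT here (bricks W0–W5 of the EX plan).  (ii) `A ∈ M₂(ℂ)` bondwise, GL exponent (`e^{A}·U₀♭`); the H side's `expCfg η A′` is `A = iη·A′`
(`expCfg_eq_expUnit`).  (iii) `Chart47T3twS` is a hypothesis SHAPE, asserted for nothing; proved only from r08's displayed `B11Prop3Model.Inputs`.  (iv) (J2) is DERIVED from the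
H side's certified engine ✓`Prop8ChartDoubleBar.exists_hasFDerivAt_coe_dbarIterU_expCfg_zero` (CERT-2 ✓p611330) — nothing of the tube computation is re-proved.  Count-neutral
toward stmt-QuantumFields-19200 (`--supports`); definitions (review lane) + unfoldings + two sanity theorems; nothing continuum ∕ OS ∕ mass-gap ∕ Clay.

References: T. Bałaban, CMP **98** (1985) 17–51 [Balaban1985Averaging] ((82) p.30, (87)–(92) p.31, (97) p.32, (125)–(127) p.36, (134) p.38); CMP **99** (1985) 75–102
[Balaban1985RegularSpaces] ((1.30)–(1.31), (1.37) pp.81–82); CMP **99** (1985) 389–434 [Balaban1985BackgroundPropagators] (p.392, (3.13)–(3.15) p.393); CMP **102** (1985)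
277–309 [Balaban1985Variational] ((20) p.281, (44)–(49) p.285, (55) p.286, (57)–(62) pp.286–287, Prop. 3 p.289, (152) p.301); CMP **95** (1984) 17–40 [Balaban1984PropagatorsI]
((1.18) p.20); CMP **109** (1987) 249–301 [Balaban1987RG1] ((0.4), (0.11) p.253).
-/

noncomputable section

open scoped Matrix.Norms.L2Operator
open Metric Set

namespace Summit.QuantumFields.YangMills.Theorems.Prop7SymAvgTwSym

open NormedSpace
open Literature.MathematicalPhysics.QuantumFieldTheory.Balaban1983to89
open T4Continuum BlockAveraging ExpMeanLog MatrixLog LatticeFieldCalculus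
open B10Eq27TorusAxialLog (holT gaugeActT gaugeActT_apply)
open B7TransferAnalyticMean (hasFDerivAt_mlog_one)
open B6SectADomainsV1 (Domains)
open B6SectAOperatorsV1 (BondIdx)
open Summit.QuantumFields.YangMills.Theorems.Prop8Chart (emlIterU emlIterU_one expCfg coe_expCfg expCfg_zero)
open Summit.QuantumFields.YangMills.Theorems.Prop8ChartDoubleBar (dbarIterU dbarIterU_one chartLogFlat chartLogFlat_apply exists_hasFDerivAt_coe_dbarIterU_expCfg_zero)
open T3ContinuumYM3Torus
open T3LevelShift (siteShift bondShift bondShift_tgt fieldShift)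
open T3PrintedRegularOrbits (sites_eq)
open T3SectALandauChart (bgUnits bgUnits_one)
open B7Prop1Explicit (expUnit val_expUnit)
open B11Prop3Model (Dfix Inputs Dfix_spec Dfix_ball Dfix_fix)
open B12Lineariz267 (mapsTo_phi phi_psi_of_norm_lt)
open Summit.QuantumFields.YangMills.Theorems.Prop7SymAvgGL (descendToGL descendToGL_eq_fieldShift_emlIterU expUnit_zero_mul_bgUnits)

/-! ## §1 The T³ letters: the accumulated symmetric frame at a comparison site and the re-based twisted chart (formulas of ✓`Prop7SymAvgTw` verbatim, `frameTwS` for `frameTw`) -/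

section T3

variable (F : T3Family) (n K : ℕ) (h : n ≤ K)

/-- **THE ACCUMULATED SYMMETRIC COVARIANT FRAME `w_A^{sym}(y)` OF THE PERTURBATION `e^{A}` RELATIVE TO `U₀`, READ AT A COMPARISON SITE** `y ∈ T^{(n)}_0 ≅ T^{(K)}_{K−n}`
(`siteShift (sites_eq F n K h)`): `frameAccU (K − n) U₀♭ (e^{A}·U₀♭) ŷ` — the SYMMETRIC, CENTRE-ANCHORED replacement of the corner-comb letter `frameTw = wrec` of ✓`Prop7SymAvgTw`
(RULING g26-№12). [cite: Balaban1985Averaging, (82) p.30, (87) p.31, (97) p.32] -/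
def frameTwS (U₀ : GaugeField (F.P K) 0 (Matrix.specialUnitaryGroup (Fin 2) ℂ)) (A : PBond (F.P K) 0 → Matrix (Fin 2) (Fin 2) ℂ)
    (y : Site (F.P n) 0) : (Matrix (Fin 2) (Fin 2) ℂ)ˣ :=
  frameAccU (K - n) (bgUnits F K U₀) (fun b => expUnit (A b) * bgUnits F K U₀ b) (siteShift (sites_eq F n K h) y)

/-- **PRINT'S DOUBLE-BAR AVERAGE (89)–(92) WITH THE SYMMETRIC INNER AVERAGE AND THE SYMMETRIC FRAMES — the re-based twisted descended perturbation**: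
`U̿^{twS}(A)(c) := w_A^{sym}(c₋)⁻¹ · D̄_GL(e^{A}U₀)(c) · w_A^{sym}(c₊) · D̄_GL(U₀)(c)⁻¹` — the formula of `Prop7SymAvgTw.dbarTw` with `frameTwS` for `frameTw`.
[cite: Balaban1985Averaging, (89)–(92) p.31; Balaban1985RegularSpaces, (1.30)–(1.31) pp.81–82] -/
def dbarTwS (U₀ : GaugeField (F.P K) 0 (Matrix.specialUnitaryGroup (Fin 2) ℂ)) (A : PBond (F.P K) 0 → Matrix (Fin 2) (Fin 2) ℂ)
    (c : PBond (F.P n) 0) : (Matrix (Fin 2) (Fin 2) ℂ)ˣ :=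
  (frameTwS F n K h U₀ A c.src)⁻¹ * descendToGL F n K h (fun b => expUnit (A b) * bgUnits F K U₀ b) c * frameTwS F n K h U₀ A c.tgt
    * (descendToGL F n K h (bgUnits F K U₀) c)⁻¹

/-- **THE RE-BASED TWISTED LOG-CHART `A ↦ log U̿^{twS}(A)`** — print's `Q_k(U₀, ηA)` ∕ «the function (3.13)» for the symmetric fibre with symmetric frames; complexified.
[cite: Balaban1985RegularSpaces, (1.31) p.82, (1.37) p.82; Balaban1985BackgroundPropagators, (3.13)–(3.14) p.393; Balaban1985Variational, (44) p.285] -/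
def logChartTwS (U₀ : GaugeField (F.P K) 0 (Matrix.specialUnitaryGroup (Fin 2) ℂ)) (A : PBond (F.P K) 0 → Matrix (Fin 2) (Fin 2) ℂ) :
    PBond (F.P n) 0 → Matrix (Fin 2) (Fin 2) ℂ :=
  fun c => mlog ((dbarTwS F n K h U₀ A c : (Matrix (Fin 2) (Fin 2) ℂ)ˣ) : Matrix (Fin 2) (Fin 2) ℂ)

/-- **PRINT'S AVERAGING OPERATOR `Q(U₀) := QTwS U₀`** — «Q_j(U)A is a linear part of the function (3.13)»: the Fréchet derivative of the re-based twisted log-chart at `A = 0`, read as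
a DEFINITION (at `U₀ = 1` it is the straight tube, §4; at `U₀ ≠ 1` the covariant symmetric tube — brick W of the EX plan, not here).
[cite: Balaban1985BackgroundPropagators, (3.14)–(3.15) p.393; Balaban1985Variational, (44) p.285] -/
def QTwS (U₀ : GaugeField (F.P K) 0 (Matrix.specialUnitaryGroup (Fin 2) ℂ)) :
    (PBond (F.P K) 0 → Matrix (Fin 2) (Fin 2) ℂ) →L[ℂ] (PBond (F.P n) 0 → Matrix (Fin 2) (Fin 2) ℂ) :=
  fderiv ℂ (logChartTwS F n K h U₀) 0

/-- **THE RE-BASED TWISTED REMAINDER `C(U₀, A) := log U̿^{twS}(A) − Q(U₀)A`** ((3.14)∕(44) `C_j`). [cite: Balaban1985BackgroundPropagators, (3.14) p.393; Balaban1985Variational, (44) p.285] -/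
def CmapTwS (U₀ : GaugeField (F.P K) 0 (Matrix.specialUnitaryGroup (Fin 2) ℂ)) (A : PBond (F.P K) 0 → Matrix (Fin 2) (Fin 2) ℂ) :
    PBond (F.P n) 0 → Matrix (Fin 2) (Fin 2) ℂ :=
  logChartTwS F n K h U₀ A - QTwS F n K h U₀ A

/-- **CHART-47-T³-twS — [Balaban1985Variational] PROPOSITION 3 FOR THE RE-BASED TWISTED CHART**: `Prop7SymAvgTw.Chart47T3tw`'s text VERBATIM at `CmapTwS` (with
`D := B11Prop3Model.Dfix (CmapTwS U₀) H C₂`: (49) on the `ε`-ball, the range sandwich, (55)).  ASSERTED FOR NOTHING; proved from `Inputs` below.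
[cite: Balaban1985Variational, Prop. 3 p.289, (47)–(49) p.285, (55) p.286, (57)–(62) pp.286–287] -/
def Chart47T3twS (C₂ ε : ℝ) (U₀ : GaugeField (F.P K) 0 (Matrix.specialUnitaryGroup (Fin 2) ℂ))
    (H : (PBond (F.P n) 0 → Matrix (Fin 2) (Fin 2) ℂ) →ₗ[ℂ] (PBond (F.P K) 0 → Matrix (Fin 2) (Fin 2) ℂ)) : Prop :=
  (∀ A' : PBond (F.P K) 0 → Matrix (Fin 2) (Fin 2) ℂ, ‖A'‖ < ε →
      CmapTwS F n K h U₀ (A' - H (Dfix (CmapTwS F n K h U₀) H C₂ A')) = Dfix (CmapTwS F n K h U₀) H C₂ A') ∧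
  (∀ A : PBond (F.P K) 0 → Matrix (Fin 2) (Fin 2) ℂ, ‖A‖ < ε / 2 →
      ∃ A' : PBond (F.P K) 0 → Matrix (Fin 2) (Fin 2) ℂ, ‖A'‖ < ε ∧ A' - H (Dfix (CmapTwS F n K h U₀) H C₂ A') = A) ∧
  (∀ A' : PBond (F.P K) 0 → Matrix (Fin 2) (Fin 2) ℂ, ‖A'‖ < ε → ‖A' - H (Dfix (CmapTwS F n K h U₀) H C₂ A')‖ < 2 * ε) ∧
  (∀ A' : PBond (F.P K) 0 → Matrix (Fin 2) (Fin 2) ℂ, ‖A'‖ < ε → ‖Dfix (CmapTwS F n K h U₀) H C₂ A'‖ ≤ 4 * C₂ * ‖A'‖ ^ 2)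

variable {F n K h}

/-- `frameTwS` unfolded. [cite: Balaban1985Averaging, (97) p.32] -/
theorem frameTwS_def (U₀ : GaugeField (F.P K) 0 (Matrix.specialUnitaryGroup (Fin 2) ℂ)) (A : PBond (F.P K) 0 → Matrix (Fin 2) (Fin 2) ℂ) (y : Site (F.P n) 0) :
    frameTwS F n K h U₀ A y = frameAccU (K - n) (bgUnits F K U₀) (fun b => expUnit (A b) * bgUnits F K U₀ b) (siteShift (sites_eq F n K h) y) := rfl

/-- `dbarTwS` unfolded. [cite: Balaban1985Averaging, (89) p.31] -/
theorem dbarTwS_def (U₀ : GaugeField (F.P K) 0 (Matrix.specialUnitaryGroup (Fin 2) ℂ)) (A : PBond (F.P K) 0 → Matrix (Fin 2) (Fin 2) ℂ) (c : PBond (F.P n) 0) :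
    dbarTwS F n K h U₀ A c
      = (frameTwS F n K h U₀ A c.src)⁻¹ * descendToGL F n K h (fun b => expUnit (A b) * bgUnits F K U₀ b) c * frameTwS F n K h U₀ A c.tgt
          * (descendToGL F n K h (bgUnits F K U₀) c)⁻¹ := rfl

/-- `logChartTwS` bondwise. [cite: Balaban1985RegularSpaces, (1.31) p.82] -/
theorem logChartTwS_apply (U₀ : GaugeField (F.P K) 0 (Matrix.specialUnitaryGroup (Fin 2) ℂ)) (A : PBond (F.P K) 0 → Matrix (Fin 2) (Fin 2) ℂ) (c : PBond (F.P n) 0) :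
    logChartTwS F n K h U₀ A c = mlog ((dbarTwS F n K h U₀ A c : (Matrix (Fin 2) (Fin 2) ℂ)ˣ) : Matrix (Fin 2) (Fin 2) ℂ) := rfl

/-- `QTwS` unfolded. [cite: Balaban1985BackgroundPropagators, (3.14) p.393] -/
theorem QTwS_def (U₀ : GaugeField (F.P K) 0 (Matrix.specialUnitaryGroup (Fin 2) ℂ)) : QTwS F n K h U₀ = fderiv ℂ (logChartTwS F n K h U₀) 0 := rfl

/-- `CmapTwS` bondwise: `C(U₀, A) = log U̿^{twS}(A) − Q(U₀)A`. [cite: Balaban1985Variational, (44) p.285] -/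
theorem CmapTwS_apply (U₀ : GaugeField (F.P K) 0 (Matrix.specialUnitaryGroup (Fin 2) ℂ)) (A : PBond (F.P K) 0 → Matrix (Fin 2) (Fin 2) ℂ) :
    CmapTwS F n K h U₀ A = logChartTwS F n K h U₀ A - QTwS F n K h U₀ A := rfl

/-- `log U̿^{twS}(A) = Q(U₀)A + C(U₀, A)` (by definition of the remainder). [cite: Balaban1985BackgroundPropagators, (3.14) p.393; Balaban1985Variational, (44) p.285] -/
theorem logChartTwS_eq_QTwS_add_CmapTwS (U₀ : GaugeField (F.P K) 0 (Matrix.specialUnitaryGroup (Fin 2) ℂ)) (A : PBond (F.P K) 0 → Matrix (Fin 2) (Fin 2) ℂ) :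
    logChartTwS F n K h U₀ A = QTwS F n K h U₀ A + CmapTwS F n K h U₀ A := by
  rw [CmapTwS_apply, add_sub_cancel]

/-- **CHART-47-T³-twS ⇐ r08's displayed `Inputs`** (by `exact`, as `Prop7SymAvgTw.chart47tw_of_inputs`). [cite: Balaban1985Variational, Prop. 3 p.289, (49)–(55) pp.285–286, (57)–(62) pp.286–287] -/
theorem chart47twS_of_inputs {C₂ C₃ B₀ c₄ ε : ℝ} {U₀ : GaugeField (F.P K) 0 (Matrix.specialUnitaryGroup (Fin 2) ℂ)}
    {H : (PBond (F.P n) 0 → Matrix (Fin 2) (Fin 2) ℂ) →ₗ[ℂ] (PBond (F.P K) 0 → Matrix (Fin 2) (Fin 2) ℂ)}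
    (hin : Inputs (CmapTwS F n K h U₀) H C₂ C₃ B₀ c₄) (hC₂ : 0 ≤ C₂) (hB₀ : 0 ≤ B₀) (hq : 9 * C₂ * B₀ * ε < 1) (hRC : 3 * ε ≤ 2 * c₄) :
    Chart47T3twS F n K h C₂ ε U₀ H := by
  have hQA := hin.quadAnalytic
  have hDfix := Dfix_fix (Ct := CmapTwS F n K h U₀) (hop := H) hQA hC₂ hB₀ hin.norm_H hq hRC
  have hDball := Dfix_ball (Ct := CmapTwS F n K h U₀) (hop := H) hQA hC₂ hB₀ hin.norm_H hq hRC
  refine ⟨fun A' hA' => hDfix A' hA', fun A hA => ?_, fun A' hA' => ?_, fun A' hA' => ?_⟩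
  · obtain ⟨hΨ, hΦΨ⟩ := phi_psi_of_norm_lt (Dt := Dfix (CmapTwS F n K h U₀) H C₂) hQA hC₂ hB₀ hin.norm_H hq hRC hDball hDfix hA
    exact ⟨A + H (CmapTwS F n K h U₀ A), hΨ, hΦΨ⟩
  · have hm := mapsTo_phi (Dt := Dfix (CmapTwS F n K h U₀) H C₂) hQA hC₂ hB₀ hin.norm_H hq hRC hDball hDfix (mem_ball_zero_iff.2 hA')
    exact mem_ball_zero_iff.1 hm
  · exact (Dfix_spec (Ct := CmapTwS F n K h U₀) (hop := H) hQA hC₂ hB₀ hin.norm_H hq hRC hA').1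

/-- ★ **(48)-twS**: `Chart47T3twS … U₀ H` with `H` a right inverse of `QTwS U₀` gives `log U̿^{twS}(A′ − HD(A′)) = Q(U₀)A′` on the `ε`-ball.
[cite: Balaban1985Variational, (47)–(49) p.285, Prop. 3 p.289] -/
theorem logChartTwS_eq_QTwS_of_chart47twS {C₂ ε : ℝ} {U₀ : GaugeField (F.P K) 0 (Matrix.specialUnitaryGroup (Fin 2) ℂ)}
    {H : (PBond (F.P n) 0 → Matrix (Fin 2) (Fin 2) ℂ) →ₗ[ℂ] (PBond (F.P K) 0 → Matrix (Fin 2) (Fin 2) ℂ)}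
    (h47 : Chart47T3twS F n K h C₂ ε U₀ H) (hQH : ∀ X, QTwS F n K h U₀ (H X) = X)
    (A' : PBond (F.P K) 0 → Matrix (Fin 2) (Fin 2) ℂ) (hA' : ‖A'‖ < ε) :
    logChartTwS F n K h U₀ (A' - H (Dfix (CmapTwS F n K h U₀) H C₂ A')) = QTwS F n K h U₀ A' := by
  have h49 : logChartTwS F n K h U₀ (A' - H (Dfix (CmapTwS F n K h U₀) H C₂ A'))
      - QTwS F n K h U₀ (A' - H (Dfix (CmapTwS F n K h U₀) H C₂ A')) = Dfix (CmapTwS F n K h U₀) H C₂ A' := h47.1 A' hA'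
  rw [map_sub, hQH, sub_eq_iff_eq_add] at h49
  rw [h49]
  abel

/-! ## §2 Structure: `dbarTwS` is print's (92) top-level twisted variable; the origin of the chart -/

/-- The symmetric descent read bondwise through the level identification: `D̄_GL(V)(c) = Ū^{(K−n)}(ĉ)`. [cite: Balaban1987RG1, (0.4)+(0.11) p.253] -/
theorem descendToGL_apply_eq_emlIterU (V : GaugeField (F.P K) 0 (Matrix (Fin 2) (Fin 2) ℂ)ˣ) (c : PBond (F.P n) 0) :
    descendToGL F n K h V c = emlIterU (K - n) V (bondShift (sites_eq F n K h) c) := by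
  rw [descendToGL_eq_fieldShift_emlIterU]
  rfl

/-- ★ **`dbarTwS` IS PRINT'S (92) TOP-LEVEL TWISTED VARIABLE `U̿₁^{(k)}(c) = (U̿₁Ū₀)^{(k)}(ĉ)·Ū₀^{(k)}(ĉ)⁻¹`**: the (T) formula with the accumulated symmetric frames equals the covariant
tower of §1 at the top level times the inverse background — by (97) (`dbarCovIterU_eq_gaugeActT_frameAccU`) and `descendToGL = fieldShift ∘ emlIterU`.
[cite: Balaban1985Averaging, (92) p.31, (97) p.32] -/
theorem dbarTwS_eq_dbarCovIterU_mul_inv (U₀ : GaugeField (F.P K) 0 (Matrix.specialUnitaryGroup (Fin 2) ℂ)) (A : PBond (F.P K) 0 → Matrix (Fin 2) (Fin 2) ℂ)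
    (c : PBond (F.P n) 0) :
    dbarTwS F n K h U₀ A c =
      dbarCovIterU (K - n) (bgUnits F K U₀) (fun b => expUnit (A b) * bgUnits F K U₀ b) (bondShift (sites_eq F n K h) c)
        * (emlIterU (K - n) (bgUnits F K U₀) (bondShift (sites_eq F n K h) c))⁻¹ := by
  have ht : PBond.tgt (P := F.P K) (bondShift (sites_eq F n K h) c) = siteShift (sites_eq F n K h) c.tgt := bondShift_tgt _ _
  rw [dbarTwS_def, descendToGL_apply_eq_emlIterU, descendToGL_apply_eq_emlIterU, dbarCovIterU_eq_gaugeActT_frameAccU, gaugeActT_apply, inv_inv,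
    frameTwS_def, frameTwS_def, ← ht]
  rfl

/-- the frames of the unperturbed field are trivial: `w_0^{sym} = 1`. [cite: Balaban1985Averaging, (97) p.32] -/
@[simp] theorem frameTwS_zero (U₀ : GaugeField (F.P K) 0 (Matrix.specialUnitaryGroup (Fin 2) ℂ)) (y : Site (F.P n) 0) : frameTwS F n K h U₀ 0 y = 1 := by
  rw [frameTwS_def, expUnit_zero_mul_bgUnits, frameAccU_self]

/-- **THE ORIGIN OF THE CHART**: `U̿^{twS}(0) = 1`. [cite: Balaban1985Averaging, (92) p.31] -/
@[simp] theorem dbarTwS_zero (U₀ : GaugeField (F.P K) 0 (Matrix.specialUnitaryGroup (Fin 2) ℂ)) (c : PBond (F.P n) 0) : dbarTwS F n K h U₀ 0 c = 1 := by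
  rw [dbarTwS_eq_dbarCovIterU_mul_inv, expUnit_zero_mul_bgUnits, dbarCovIterU_self, mul_inv_cancel]

/-- `log U̿^{twS}(0) = 0`. [cite: Balaban1985Variational, (44) p.285] -/
@[simp] theorem logChartTwS_zero (U₀ : GaugeField (F.P K) 0 (Matrix.specialUnitaryGroup (Fin 2) ℂ)) : logChartTwS F n K h U₀ 0 = 0 := by
  funext c
  rw [logChartTwS_apply, dbarTwS_zero, Units.val_one, mlog_one, Pi.zero_apply]

/-! ## §3 (J1) on T³: at `U₀ = 1` the re-based chart IS the H side's double-bar chart of record -/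

/-- ★ **(J1) T³ — AT THE TRIVIAL BACKGROUND `dbarTwS` IS ✓`Prop8ChartDoubleBar.dbarIterU` OF THE PERTURBATION** read at `ĉ`: `U̿^{twS}(A)(c) = U̿^{(K−n)}(e^{A})(ĉ)` — literally
(`bgUnits_one`, `emlIterU_one`, `dbarCovIterU_one`). [cite: Balaban1985Averaging, (92) p.31, (127) p.36] -/
theorem dbarTwS_one (A : PBond (F.P K) 0 → Matrix (Fin 2) (Fin 2) ℂ) (c : PBond (F.P n) 0) :
    dbarTwS F n K h 1 A c = dbarIterU (K - n) (fun b => expUnit (A b)) (bondShift (sites_eq F n K h) c) := by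
  rw [dbarTwS_eq_dbarCovIterU_mul_inv, bgUnits_one]
  simp only [mul_one]
  rw [dbarCovIterU_one, emlIterU_one, inv_one, mul_one]

/-- **(J1) T³ — the accumulated symmetric frame at the trivial background** is the H side's accumulated frame of the perturbation: `w_A^{sym}(y) = frameAccU (K−n) 1 (e^{A}) ŷ`.
[cite: Balaban1985Averaging, (97) p.32] -/
theorem frameTwS_one (A : PBond (F.P K) 0 → Matrix (Fin 2) (Fin 2) ℂ) (y : Site (F.P n) 0) :
    frameTwS F n K h 1 A y = frameAccU (K - n) (fun _ : PBond (F.P K) 0 => (1 : (Matrix (Fin 2) (Fin 2) ℂ)ˣ)) (fun b => expUnit (A b)) (siteShift (sites_eq F n K h) y) := by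
  rw [frameTwS_def, bgUnits_one]
  simp only [mul_one]

/-- ★ **(J1) T³ — THE RE-BASED LOG-CHART AT `U₀ = 1`**: `log U̿^{twS}(A)(c) = log U̿^{(K−n)}(e^{A})(ĉ)`. [cite: Balaban1985Variational, (20) p.281, (44) p.285] -/
theorem logChartTwS_one_apply (A : PBond (F.P K) 0 → Matrix (Fin 2) (Fin 2) ℂ) (c : PBond (F.P n) 0) :
    logChartTwS F n K h 1 A c
      = mlog ((dbarIterU (K - n) (fun b => expUnit (A b)) (bondShift (sites_eq F n K h) c) : (Matrix (Fin 2) (Fin 2) ℂ)ˣ) : Matrix (Fin 2) (Fin 2) ℂ) := by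
  rw [logChartTwS_apply, dbarTwS_one]

/-- the `η` bookkeeping: the H side's charted configuration `e^{iηA′}` (`Prop8Chart.expCfg`) is the GL exponent `A = iη·A′` of this file. [cite: Balaban1985Variational, (152) p.301] -/
theorem expCfg_eq_expUnit (η : ℝ) (A' : PBond (F.P K) 0 → Matrix (Fin 2) (Fin 2) ℂ) :
    expCfg η A' = fun b => expUnit ((Complex.I * (η : ℂ)) • A' b) := by
  funext b
  apply Units.ext
  rw [coe_expCfg, val_expUnit]

/-- ★ **(J1) T³ — THE DISPLAYED `η`∕INDEX BOOKKEEPING AGAINST ✓`Prop8ChartDoubleBar.chartLogFlat`**: for every nested family `D` reading the top-level index `(K − n, ĉ)`,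
`chartLogFlat η D A′ (K − n, ĉ) = −i · logChartTwS 1 (iη·A′) c` — ONE chart functional for the route at `U₀ = 1` (RULING g26-№12).
[cite: Balaban1985Variational, (20) p.281, (44) p.285; Balaban1985Averaging, (134) p.38] -/
theorem chartLogFlat_eq_logChartTwS_one (η : ℝ) (D : Domains (F.P K)) (A' : PBond (F.P K) 0 → Matrix (Fin 2) (Fin 2) ℂ) (c : PBond (F.P n) 0)
    (hk : K - n < D.k + 1) (hmem : D.LamBond (K - n) (bondShift (sites_eq F n K h) c)) :
    chartLogFlat η D A' ⟨⟨⟨K - n, hk⟩, bondShift (sites_eq F n K h) c⟩, hmem⟩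
      = (-Complex.I) • logChartTwS F n K h 1 (fun b => (Complex.I * (η : ℂ)) • A' b) c := by
  rw [chartLogFlat_apply, logChartTwS_one_apply, expCfg_eq_expUnit]

/-! ## §4 (J2): the linear part at `U₀ = 1` is the straight tube — no leg term -/

/-- ★★ **(J2) — `QTwS 1 = tube^{(k)}` EXACTLY, NO COARSE-GRADIENT DEFECT**: `QTwS F n K h 1 Y c = L^{K−n}·(bondAvgIter (K−n) Y)(ĉ)` — the straight `(K−n)`-fold tube average of
[Balaban1984PropagatorsI] (1.18) (print's `LᵏηQ_k` at `Lᵏη = 1` in the GL exponent), the frames' legs cancelling against the symmetric average's legs as in print's (125).  FROM the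
H side's certified engine ✓`Prop8ChartDoubleBar.exists_hasFDerivAt_coe_dbarIterU_expCfg_zero` (CERT-2) at `η = 1` through (J1) and the chain rule along `A ↦ −i·A`; nothing of the tube
computation is re-proved.  Contrast ✓`Prop7SymAvgTw.QTw 1 = tube^{(k)} + δ(S_comb − S_sym)` (corner frames). [cite: Balaban1985Averaging, (125)–(127) p.36; Balaban1984PropagatorsI, (1.18) p.20;
Balaban1985Variational, (44)–(45) p.285] -/
theorem QTwS_one_apply (Y : PBond (F.P K) 0 → Matrix (Fin 2) (Fin 2) ℂ) (c : PBond (F.P n) 0) :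
    QTwS F n K h 1 Y c = ((((F.P K).L : ℕ) : ℂ) ^ (K - n)) • bondAvgIter (K - n) Y (bondShift (sites_eq F n K h) c) := by
  -- the rescaling `A ↦ −i·A`
  set m : (PBond (F.P K) 0 → Matrix (Fin 2) (Fin 2) ℂ) →L[ℂ] (PBond (F.P K) 0 → Matrix (Fin 2) (Fin 2) ℂ) :=
    (-Complex.I) • ContinuousLinearMap.id ℂ (PBond (F.P K) 0 → Matrix (Fin 2) (Fin 2) ℂ) with hm
  have hmA : ∀ A : PBond (F.P K) 0 → Matrix (Fin 2) (Fin 2) ℂ, m A = (-Complex.I) • A := fun A => rfl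
  have hm0 : m 0 = 0 := by rw [hmA, smul_zero]
  -- (J1): the chart at background 1 as the H tower of `expCfg 1 (m A)`
  have hfun : logChartTwS F n K h 1 = fun A c =>
      mlog ((dbarIterU (K - n) (expCfg 1 (m A)) (bondShift (sites_eq F n K h) c) : (Matrix (Fin 2) (Fin 2) ℂ)ˣ) : Matrix (Fin 2) (Fin 2) ℂ) := by
    funext A c
    rw [logChartTwS_one_apply, expCfg_eq_expUnit]
    congr 3
    funext b
    rw [hmA, Pi.smul_apply, smul_smul, Complex.ofReal_one, mul_one, show Complex.I * -Complex.I = 1 by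
      rw [mul_neg, Complex.I_mul_I, neg_neg], one_smul]
  -- CERT-2's engine, level `K − n`, at every top-level bond
  choose Dm hDm hDmY using fun c' : PBond (F.P K) (K - n) =>
    exists_hasFDerivAt_coe_dbarIterU_expCfg_zero (P := F.P K) (n := Fin 2) (1 : ℝ) (K - n) c'
  have hcomp : ∀ c' : PBond (F.P K) (K - n), HasFDerivAt
      (fun A : PBond (F.P K) 0 → Matrix (Fin 2) (Fin 2) ℂ => ((dbarIterU (K - n) (expCfg 1 (m A)) c' : (Matrix (Fin 2) (Fin 2) ℂ)ˣ) : Matrix (Fin 2) (Fin 2) ℂ))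
      ((Dm c').comp m) 0 := by
    intro c'
    have h1 : HasFDerivAt (fun A' : PBond (F.P K) 0 → Matrix (Fin 2) (Fin 2) ℂ =>
        ((dbarIterU (K - n) (expCfg 1 A') c' : (Matrix (Fin 2) (Fin 2) ℂ)ˣ) : Matrix (Fin 2) (Fin 2) ℂ)) (Dm c') (m 0) := by
      rw [hm0]; exact hDm c'
    exact h1.comp (0 : PBond (F.P K) 0 → Matrix (Fin 2) (Fin 2) ℂ) m.hasFDerivAt
  have hval : ∀ c' : PBond (F.P K) (K - n),
      ((dbarIterU (K - n) (expCfg 1 (m 0)) c' : (Matrix (Fin 2) (Fin 2) ℂ)ˣ) : Matrix (Fin 2) (Fin 2) ℂ) = 1 := by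
    intro c'; rw [hm0, expCfg_zero, dbarIterU_one, Units.val_one]
  have hlog : ∀ c' : PBond (F.P K) (K - n), HasFDerivAt
      (fun A : PBond (F.P K) 0 → Matrix (Fin 2) (Fin 2) ℂ => mlog ((dbarIterU (K - n) (expCfg 1 (m A)) c' : (Matrix (Fin 2) (Fin 2) ℂ)ˣ) : Matrix (Fin 2) (Fin 2) ℂ))
      ((1 : Matrix (Fin 2) (Fin 2) ℂ →L[ℂ] Matrix (Fin 2) (Fin 2) ℂ).comp ((Dm c').comp m)) 0 := by
    intro c'
    have hl : HasFDerivAt (mlog : Matrix (Fin 2) (Fin 2) ℂ → Matrix (Fin 2) (Fin 2) ℂ) (1 : Matrix (Fin 2) (Fin 2) ℂ →L[ℂ] Matrix (Fin 2) (Fin 2) ℂ)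
        ((dbarIterU (K - n) (expCfg 1 (m 0)) c' : (Matrix (Fin 2) (Fin 2) ℂ)ˣ) : Matrix (Fin 2) (Fin 2) ℂ) := by
      rw [hval]; exact hasFDerivAt_mlog_one
    have hlc := hl.comp (0 : PBond (F.P K) 0 → Matrix (Fin 2) (Fin 2) ℂ) (hcomp c')
    exact hlc
  have hpi : HasFDerivAt (logChartTwS F n K h 1)
      (ContinuousLinearMap.pi fun c : PBond (F.P n) 0 =>
        (1 : Matrix (Fin 2) (Fin 2) ℂ →L[ℂ] Matrix (Fin 2) (Fin 2) ℂ).comp ((Dm (bondShift (sites_eq F n K h) c)).comp m)) 0 := by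
    rw [hfun]
    exact hasFDerivAt_pi.mpr fun c => hlog (bondShift (sites_eq F n K h) c)
  rw [QTwS_def, hpi.fderiv, ContinuousLinearMap.pi_apply, ContinuousLinearMap.one_def, ContinuousLinearMap.id_comp, ContinuousLinearMap.comp_apply, hmA,
    map_smul, hDmY, smul_smul, smul_smul, Complex.ofReal_one, mul_one, show -Complex.I * Complex.I = 1 by rw [neg_mul, Complex.I_mul_I, neg_neg], one_mul]

end T3

end Summit.QuantumFields.YangMills.Theorems.Prop7SymAvgTwSym

end
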